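import Mathlib.Analysis.Fourier.FourierTransformDeriv
import Mathlib.Analysis.Fourier.Inversion
import Literature.Analysis.FluidPDE.TaoAveragedEulerProofs
import Literature.Analysis.FluidPDE.SolenoidalL2Duality
import Literature.Analysis.FunctionSpaces.PlancherelL1L2
import HarnessLib

/-!
# The function-level Leray projector agrees with the `L²` Leray projector on test fields (discharge)

Discharge of the named fact `Literature.Analysis.FluidPDE.lerayProjFun_ae_eq_lerayProjector` of
`Literature/Analysis/FluidPDE/TaoAveragedEuler.lean` (Lemarié-Rieusset 2002, Ch. 11: the Leray
projector `ℙ` is the Fourier multiplier `I − ξ ⊗ ξ/|ξ|²`): for `v ∈ L²(ℝ^ι; ℝ^ι)` with a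
test-field representative `φ`, the accepted `L²` Leray projector
`lerayProjector (EuclideanSpace ℝ ι) v` (the orthogonal projection onto `L²_σ = closure 𝒱`,
`LerayProjector.lean`) is represented a.e. by the function-level
`lerayProjFun φ = Re 𝓕⁻[P̂(ξ) φ̂(ξ)]` of `TaoAveragedEuler.lean`.

This is a sibling proof file of `TaoAveragedEulerProofs.lean` (discharges of
`lerayProjFun_eq_self_of_isDivFree` and `hasCancellation_eulerBilinear`), whose Part 1
(`LerayDivFree`) lemmas it reuses; it adds theorems only (no definitions, no notation).

## Proof

Write `g(ξ) = P̂(ξ) φ̂(ξ)` (`leraySymbolC ξ (fourierVec φ ξ)`), `F = 𝓕⁻ g`, `Pφ = Re F`. Steps 1–3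
are proved for every *Schwartz* field `φ` (dot-notation lemmas on `IsSchwartzField`); the fact
itself is stated for test fields (`IsSchwartzField.of_isTestFunctionOn`).

1. `φ̂` is a Schwartz function and `‖P̂(ξ) c‖ ≤ 2‖c‖` (`norm_leraySymbolC_le`, sibling file),
   so `g ∈ L¹ ∩ L²`; by Plancherel on `L¹ ∩ L²` (tree,
   `FunctionSpaces.memLp_two_fourierIntegral`) `F ∈ L²`, hence `Pφ ∈ L² ∩ C⁰`
   (`IsSchwartzField.memLp_two_lerayProjFun`).
2. Pairings on the Fourier side (`IsSchwartzField.integral_inner_lerayProjFun_eq_re`): for a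
   compactly supported continuous real field `Ψ`, `∫ ⟪Pφ, Ψ⟫ = Re ∫ ⟨g, 𝓕Ψℂ⟩` (duality
   `∫⟨𝓕⁻G, Ψ⟩ = ∫⟨G, 𝓕Ψ⟩` for `L¹` data, `integral_inner_fourierInv_left_eq`, from Mathlib's
   sesquilinear multiplication formula `VectorFourier.integral_sesq_fourierIntegral_eq_neg_flip`).
3. `Pφ` is weakly divergence free (`IsSchwartzField.isWeaklyDivFree_lerayProjFun`): with
   `Ψ = ∇θ`, `𝓕[∂ⱼθ] = 2πi ξⱼ θ̂` (`fourier_fderiv_apply_ofReal`, Mathlib's `Real.fourier_fderiv`)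
   and `∑ⱼ ξⱼ g(ξ)ⱼ = 0` (`sum_mul_leraySymbolC_apply`); hence `[Pφ] ∈ L²_σ` by the tree's
   Helmholtz characterisation `mem_solenoidalL2_iff_holds` (Temam 1977, Ch. I, Thm. 1.4/1.6).
4. `φ − Pφ ⊥ 𝒱` (`IsSchwartzField.integral_inner_lerayProjFun_eq`): for `ψ ∈ C_{c,σ}^∞`,
   `∑ⱼ ξⱼ ψ̂ⱼ = 0` (sibling file, `LerayDivFree.sum_coord_mul_fourierVec_eq_zero`), so
   `⟨g, ψ̂⟩ = ⟨φ̂, ψ̂⟩` pointwise, and `∫⟨φ̂, ψ̂⟩ = ∫⟨φ, ψ⟩` by duality and Fourier inversion; by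
   continuity `v − [Pφ] ⊥ L²_σ`.
5. The orthogonal projection is characterised by 3–4 (Mathlib
   `Submodule.eq_starProjection_of_mem_orthogonal`), so `lerayProjector v = [Pφ]`
   (`lerayProjFun_ae_eq_lerayProjector_holds`).

Everything is dimension-free (`ι` any `Fintype`; for `#ι ≤ 1` both sides vanish, consistently).

## Mathlib / tree search

Mathlib (this pin): `Real.fourier_fderiv`, `Real.fourier_continuousLinearMap_apply`,
`VectorFourier.integral_sesq_fourierIntegral_eq_neg_flip`, `Continuous.fourierInv_fourier_eq`,
`HasCompactSupport.toSchwartzMap`, `SchwartzMap.postcompCLM`, `SchwartzMap.memLp`,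
`Submodule.eq_starProjection_of_mem_orthogonal`; no Leray projector. Tree: `PlancherelL1L2`
(`memLp_two_fourierIntegral`, `continuous_fourierIntegral`), `SolenoidalL2Duality`
(`mem_solenoidalL2_iff_holds`), `WeakGradientIBP`
(`integrable_inner_of_locallyIntegrable_of_hasCompactSupport`), `TaoAveragedEulerProofs`
(Part 1: `LerayDivFree.fourier_apply_coord`, `LerayDivFree.integrable_fourierVec`,
`LerayDivFree.sum_coord_mul_fourierVec_eq_zero`; cancellation part: `norm_leraySymbolC_le` — that
part, landed while this file was written, also proves, for Schwartz *maps* and with the opposite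
orientation of the inner products, variants of `integral_inner_fourierInv_left_eq` and
`IsSchwartzField.integral_inner_lerayProjFun_eq`; here these are stated for integrable data,
`IsSchwartzField` functions and test fields, in the form the main proof consumes). The `ℝ³`
special case with a Gaussian in place of a test field is `LerayHeatTest.lean`; nothing there is
stated for general `ι` (`lean search 'lerayProjFun|lerayProjector' --decl`).

## References

* P. G. Lemarié-Rieusset, *Recent developments in the Navier–Stokes problem*, Chapman &
  Hall/CRC Res. Notes Math. 431 (2002), Ch. 11 (the Leray projector as the Fourier multiplier
  `I − ξ ⊗ ξ/|ξ|²`). [`LemarieRieusset2002`]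
* R. Temam, *Navier–Stokes Equations* (North-Holland 1977), Ch. I, Thm. 1.4, Rem. 1.6, Thm. 1.6
  (`L²_σ` = weakly divergence-free fields). [`Temam1977`]
* E. M. Stein, G. Weiss, *Introduction to Fourier Analysis on Euclidean Spaces* (PUP 1971),
  Ch. I, §1–2 (multiplication formula, derivatives, Plancherel).
-/

noncomputable section

open MeasureTheory FourierTransform TopologicalSpace Set Function Filter Complex Real
open scoped InnerProductSpace RealInnerProductSpace SchwartzMap ENNReal NNReal ContDiff
  ComplexConjugate
open Literature.Analysis.FunctionSpaces (IsTestFunctionOn)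
open Literature.Analysis.FunctionSpaces.EuclideanSpace (complexify complexify_apply norm_complexify
  inner_complexify continuous_complexify contDiff_complexify_comp_iff)

namespace Literature.Analysis.FluidPDE

variable {ι : Type*} [Fintype ι]

/-! ### Fourier integrals of vector fields: coordinates, duality, derivatives -/

/-- **Fourier transform of a partial derivative**: for a real `C¹` function `θ` with compact
support, `𝓕[∂ₐθ](ξ) = 2πi ⟪ξ, a⟫ 𝓕[θ](ξ)` (complexified; Mathlib's `Real.fourier_fderiv`;
Stein–Weiss 1971, Ch. I, Thm. 1.8). [folklore] -/
theorem fourier_fderiv_apply_ofReal {θ : EuclideanSpace ℝ ι → ℝ} (hθ : ContDiff ℝ 1 θ)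
    (hθc : HasCompactSupport θ) (a ξ : EuclideanSpace ℝ ι) :
    𝓕 (fun x => ((fderiv ℝ θ x a : ℝ) : ℂ)) ξ =
      (2 * π * I * (⟪ξ, a⟫_ℝ : ℂ)) * 𝓕 (fun x => (θ x : ℂ)) ξ := by
  set θc : EuclideanSpace ℝ ι → ℂ := fun x => (θ x : ℂ) with hθc_def
  have hθc1 : ContDiff ℝ 1 θc := ofRealCLM.contDiff.comp hθ
  have hdiff : Differentiable ℝ θc := hθc1.differentiable one_ne_zero
  have hsupp : HasCompactSupport θc := hθc.comp_left Complex.ofReal_zero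
  have hint : Integrable θc := hθc1.continuous.integrable_of_hasCompactSupport hsupp
  have hint' : Integrable (fderiv ℝ θc) :=
    (hθc1.continuous_fderiv one_ne_zero).integrable_of_hasCompactSupport (hsupp.fderiv (𝕜 := ℝ))
  have hfd : ∀ x, fderiv ℝ θc x a = ((fderiv ℝ θ x a : ℝ) : ℂ) := by
    intro x
    have h := ofRealCLM.hasFDerivAt.comp x (hθ.differentiable one_ne_zero x).hasFDerivAt
    have hθc_eq : θc = ⇑ofRealCLM ∘ θ := rfl
    rw [hθc_eq, h.fderiv]
    rfl
  have h := Real.fourier_fderiv hint hdiff hint'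
  have h2 : 𝓕 (fun x => fderiv ℝ θc x a) ξ = 𝓕 (fderiv ℝ θc) ξ a :=
    (Real.fourier_continuousLinearMap_apply hint').symm
  calc 𝓕 (fun x => ((fderiv ℝ θ x a : ℝ) : ℂ)) ξ
      = 𝓕 (fun x => fderiv ℝ θc x a) ξ := by simp_rw [hfd]
    _ = 𝓕 (fderiv ℝ θc) ξ a := h2
    _ = VectorFourier.fourierSMulRight (-innerSL ℝ) (𝓕 θc) ξ a := by rw [h]
    _ = (2 * π * I * (⟪ξ, a⟫_ℝ : ℂ)) * 𝓕 θc ξ := by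
        rw [VectorFourier.fourierSMulRight_apply, neg_apply, neg_apply, innerSL_apply_apply,
          Complex.real_smul, smul_eq_mul]
        push_cast
        ring

/-- **Duality of the Fourier integral on vector-valued `L¹` functions**: `∫ ⟨𝓕⁻ G, Ψ⟩ = ∫ ⟨G, 𝓕 Ψ⟩`
for integrable `G, Ψ : ℝ^ι → ℂ^ι` (the adjoint of `𝓕` is `𝓕⁻`; Fubini, Mathlib's
`VectorFourier.integral_sesq_fourierIntegral_eq_neg_flip` with the sesquilinear inner product;
Stein–Weiss 1971, Ch. I, Thm. 1.15 (multiplication formula)). [folklore] -/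
theorem integral_inner_fourierInv_left_eq {G Ψ : EuclideanSpace ℝ ι → EuclideanSpace ℂ ι}
    (hG : Integrable G) (hΨ : Integrable Ψ) :
    ∫ x, ⟪𝓕⁻ G x, Ψ x⟫_ℂ = ∫ ξ, ⟪G ξ, 𝓕 Ψ ξ⟫_ℂ := by
  have h := VectorFourier.integral_sesq_fourierIntegral_eq_neg_flip
    (innerSL ℂ (E := EuclideanSpace ℂ ι)) (e := 𝐞) (μ := volume) (ν := volume)
    (L := innerₗ (EuclideanSpace ℝ ι)) (f := Ψ) (g := G)
    Real.continuous_fourierChar continuous_inner hΨ hG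
  rw [flip_innerₗ] at h
  simp only [innerSL_apply_apply] at h
  -- h : ∫ ξ, ⟪𝓕 Ψ ξ, G ξ⟫ = ∫ x, ⟪Ψ x, 𝓕⁻ G x⟫
  have h' := congrArg conj h
  rw [← integral_conj, ← integral_conj] at h'
  simp only [inner_conj_symm] at h'
  exact h'.symm



/-! ### The complexified Leray symbol -/

/-- The bilinear pairing `∑ᵢ ξᵢ cᵢ` is the inner product with the complexified (real) vector `ξ`.
[folklore] -/
theorem sum_ofReal_mul_eq_inner (ξ : EuclideanSpace ℝ ι) (c : EuclideanSpace ℂ ι) :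
    ∑ i, (ξ i : ℂ) * c i = ⟪complexify ξ, c⟫_ℂ := by
  simp [PiLp.inner_apply, RCLike.inner_apply, mul_comm]

/-- Coordinates of the complexified Leray symbol: `(P̂(ξ)c)ⱼ = cⱼ − (ξ·c/|ξ|²) ξⱼ`
(Lemarié-Rieusset 2002, Ch. 11). [cite: LemarieRieusset2002, Ch. 11] -/
theorem leraySymbolC_apply (ξ : EuclideanSpace ℝ ι) (c : EuclideanSpace ℂ ι) (j : ι) :
    leraySymbolC ξ c j = c j - (∑ i, (ξ i : ℂ) * c i) / ((‖ξ‖ ^ 2 : ℝ) : ℂ) * (ξ j : ℂ) := by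
  simp [leraySymbolC, smul_eq_mul]

/-- `P̂(ξ) c ⊥ ξ`: `∑ⱼ ξⱼ (P̂(ξ) c)ⱼ = 0` for every `ξ` (including the junk value at `ξ = 0`), i.e.
`P̂(ξ)` maps into `ξ^⊥` — the Fourier side of `div ℙ = 0` (Lemarié-Rieusset 2002, Ch. 11).
[cite: LemarieRieusset2002, Ch. 11] -/
theorem sum_mul_leraySymbolC_apply (ξ : EuclideanSpace ℝ ι) (c : EuclideanSpace ℂ ι) :
    ∑ j, (ξ j : ℂ) * leraySymbolC ξ c j = 0 := by
  set s : ℂ := ∑ i, (ξ i : ℂ) * c i with hs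
  set N : ℂ := ((‖ξ‖ ^ 2 : ℝ) : ℂ) with hN
  have hNsum : ∑ j, (ξ j : ℂ) * (ξ j : ℂ) = N := by
    rw [hN, EuclideanSpace.real_norm_sq_eq]
    push_cast
    exact Finset.sum_congr rfl fun j _ => by ring
  have h1 : ∑ j, (ξ j : ℂ) * leraySymbolC ξ c j = s - s / N * N := by
    simp_rw [leraySymbolC_apply, mul_sub, Finset.sum_sub_distrib]
    rw [← hs, ← hN, ← hNsum, Finset.mul_sum]
    congr 1
    exact Finset.sum_congr rfl fun j _ => by ring
  rw [h1]
  by_cases hN0 : N = 0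
  · have hξ : ξ = 0 := by
      have : ‖ξ‖ ^ 2 = 0 := by rw [hN] at hN0; exact_mod_cast hN0
      exact norm_eq_zero.1 (pow_eq_zero_iff two_ne_zero |>.1 this)
    simp [hs, hξ]
  · rw [div_mul_cancel₀ s hN0, sub_self]

/-- Against a vector `w ⊥ ξ` the symbol is invisible: `⟨P̂(ξ) c, w⟩ = ⟨c, w⟩` (`P̂(ξ) − I` has range
`ℂ ξ`; Lemarié-Rieusset 2002, Ch. 11). [cite: LemarieRieusset2002, Ch. 11] -/
theorem inner_leraySymbolC_left_of_sum_eq_zero (ξ : EuclideanSpace ℝ ι) (c w : EuclideanSpace ℂ ι)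
    (hw : ∑ j, (ξ j : ℂ) * w j = 0) : ⟪leraySymbolC ξ c, w⟫_ℂ = ⟪c, w⟫_ℂ := by
  rw [leraySymbolC, inner_sub_left, inner_smul_left, ← sum_ofReal_mul_eq_inner, hw, mul_zero,
    sub_zero]

/-- Measurability of `ξ ↦ P̂(ξ) c(ξ)` for measurable `c`. [folklore] -/
theorem measurable_leraySymbolC {c : EuclideanSpace ℝ ι → EuclideanSpace ℂ ι} (hc : Measurable c) :
    Measurable fun ξ => leraySymbolC ξ (c ξ) := by
  unfold leraySymbolC
  have hcoord : ∀ i, Measurable fun ξ => c ξ i := fun i =>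
    (EuclideanSpace.proj i : (EuclideanSpace ℂ ι) →L[ℂ] ℂ).measurable.comp hc
  have hs : Measurable fun ξ : EuclideanSpace ℝ ι => ∑ i, (ξ i : ℂ) * c ξ i :=
    Finset.measurable_sum _ fun i _ =>
      (measurable_ofReal.comp
        (EuclideanSpace.proj i : EuclideanSpace ℝ ι →L[ℝ] ℝ).measurable).mul (hcoord i)
  have hN : Measurable fun ξ : EuclideanSpace ℝ ι => ((‖ξ‖ ^ 2 : ℝ) : ℂ) :=
    measurable_ofReal.comp (continuous_norm.pow 2).measurable
  exact hc.sub ((hs.div hN).smul (complexify (ι := ι)).continuous.measurable)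

/-! ### Real parts -/

/-- Real pairings against a real part: `⟪Re w, r⟫_ℝ = Re ⟨w, rℂ⟩`. [folklore] -/
theorem inner_realPart_left (w : EuclideanSpace ℂ ι) (r : EuclideanSpace ℝ ι) :
    ⟪realPart w, r⟫_ℝ = (⟪w, complexify r⟫_ℂ).re := by
  simp only [PiLp.inner_apply, realPart_apply, complexify_apply, Complex.re_sum, RCLike.inner_apply,
    conj_trivial, Complex.mul_re, Complex.conj_re, Complex.conj_im, Complex.ofReal_re,
    Complex.ofReal_im]
  refine Finset.sum_congr rfl fun i _ => ?_
  ring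

omit [Fintype ι] in
/-- `realPart` commutes with subtraction. [folklore] -/
theorem realPart_sub (v w : EuclideanSpace ℂ ι) : realPart (v - w) = realPart v - realPart w := by
  ext i; simp

/-- The real part `ℂ^ι → ℝ^ι` is `1`-Lipschitz (`|Re z| ≤ |z|` coordinatewise). [folklore] -/
theorem lipschitzWith_one_realPart :
    LipschitzWith 1 (realPart : EuclideanSpace ℂ ι → EuclideanSpace ℝ ι) := by
  refine LipschitzWith.of_dist_le_mul fun v w => ?_
  rw [dist_eq_norm, dist_eq_norm, ← realPart_sub, NNReal.coe_one, one_mul, EuclideanSpace.norm_eq,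
    EuclideanSpace.norm_eq]
  gcongr with i
  rw [realPart_apply, Real.norm_eq_abs]
  exact Complex.abs_re_le_norm _

/-- The real part is continuous. [folklore] -/
theorem continuous_realPart : Continuous (realPart : EuclideanSpace ℂ ι → EuclideanSpace ℝ ι) :=
  lipschitzWith_one_realPart.continuous

/-! ### The Fourier data of a Schwartz field -/

section SchwartzField

/-- A test field is a Schwartz field (`C_c^∞ ⊆ 𝓢`, Mathlib's `HasCompactSupport.toSchwartzMap`).
[folklore] -/
theorem IsSchwartzField.of_isTestFunctionOn {φ : EuclideanSpace ℝ ι → EuclideanSpace ℝ ι}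
    (hφ : IsTestFunctionOn (⊤ : Opens (EuclideanSpace ℝ ι)) φ) : IsSchwartzField φ :=
  ⟨hφ.hasCompactSupport.toSchwartzMap hφ.contDiff, rfl⟩

/-- A Schwartz field, complexified, is a Schwartz map (Mathlib's `SchwartzMap.postcompCLM` of the
accepted isometry `complexify`) whose Fourier transform is `fourierVec φ`. [folklore] -/
theorem IsSchwartzField.exists_schwartz_fourierVec {φ : EuclideanSpace ℝ ι → EuclideanSpace ℝ ι}
    (hφ : IsSchwartzField φ) :
    ∃ Φ : 𝓢(EuclideanSpace ℝ ι, EuclideanSpace ℂ ι),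
      (Φ : EuclideanSpace ℝ ι → EuclideanSpace ℂ ι) = complexify ∘ φ ∧
      ((𝓕 Φ : 𝓢(EuclideanSpace ℝ ι, EuclideanSpace ℂ ι)) :
          EuclideanSpace ℝ ι → EuclideanSpace ℂ ι) = fourierVec φ := by
  obtain ⟨g, rfl⟩ := hφ
  exact ⟨SchwartzMap.postcompCLM (𝕜 := ℝ) (complexify (ι := ι)).toContinuousLinearMap g, rfl, rfl⟩

/-- `φ̂` is continuous (Schwartz). [folklore] -/
theorem IsSchwartzField.continuous_fourierVec {φ : EuclideanSpace ℝ ι → EuclideanSpace ℝ ι}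
    (hφ : IsSchwartzField φ) :
    Continuous (fourierVec φ) := by
  obtain ⟨Φ, -, hΦ⟩ := hφ.exists_schwartz_fourierVec
  rw [← hΦ]
  exact (𝓕 Φ).continuous

/-- `φ̂ ∈ L²` (Schwartz). [folklore] -/
theorem IsSchwartzField.memLp_two_fourierVec {φ : EuclideanSpace ℝ ι → EuclideanSpace ℝ ι}
    (hφ : IsSchwartzField φ) :
    MemLp (fourierVec φ) 2 (volume : Measure (EuclideanSpace ℝ ι)) := by
  obtain ⟨Φ, -, hΦ⟩ := hφ.exists_schwartz_fourierVec
  rw [← hΦ]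
  exact (𝓕 Φ).memLp 2

/-- Fourier inversion for a Schwartz field: `𝓕⁻ φ̂ = φℂ` (Mathlib's
`Continuous.fourierInv_fourier_eq`; Stein–Weiss 1971, Ch. I, Cor. 1.21). [folklore] -/
theorem IsSchwartzField.fourierInv_fourierVec {φ : EuclideanSpace ℝ ι → EuclideanSpace ℝ ι}
    (hφ : IsSchwartzField φ) :
    𝓕⁻ (fourierVec φ) = complexify ∘ φ := by
  have hF : Integrable (fourierVec φ) := LerayDivFree.integrable_fourierVec hφ
  obtain ⟨g, rfl⟩ := hφ
  have hc : Continuous (complexify ∘ ⇑g) := continuous_complexify.comp g.continuous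
  have hci : Integrable (complexify ∘ ⇑g) :=
    (complexify (ι := ι)).toContinuousLinearMap.integrable_comp (g.integrable (μ := volume))
  exact hc.fourierInv_fourier_eq hci hF

/-- The projected spectrum `P̂ φ̂` is integrable (`‖P̂(ξ) c‖ ≤ 2‖c‖`, `norm_leraySymbolC_le` of the
sibling file). [folklore] -/
theorem IsSchwartzField.integrable_leraySymbolC_fourierVec
    {φ : EuclideanSpace ℝ ι → EuclideanSpace ℝ ι} (hφ : IsSchwartzField φ) :
    Integrable fun ξ : EuclideanSpace ℝ ι => leraySymbolC ξ (fourierVec φ ξ) :=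
  Integrable.mono' ((LerayDivFree.integrable_fourierVec hφ).norm.const_mul 2)
    (measurable_leraySymbolC hφ.continuous_fourierVec.measurable).aestronglyMeasurable
    (Eventually.of_forall fun ξ => norm_leraySymbolC_le ξ _)

/-- The projected spectrum `P̂ φ̂` is square integrable. [folklore] -/
theorem IsSchwartzField.memLp_two_leraySymbolC_fourierVec
    {φ : EuclideanSpace ℝ ι → EuclideanSpace ℝ ι} (hφ : IsSchwartzField φ) :
    MemLp (fun ξ : EuclideanSpace ℝ ι => leraySymbolC ξ (fourierVec φ ξ)) 2
      (volume : Measure (EuclideanSpace ℝ ι)) :=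
  MemLp.of_le_mul hφ.memLp_two_fourierVec
    (measurable_leraySymbolC hφ.continuous_fourierVec.measurable).aestronglyMeasurable
    (Eventually.of_forall fun ξ => norm_leraySymbolC_le ξ _)

/-- Unfolding `lerayProjFun φ = Re 𝓕⁻[P̂ φ̂]`. [folklore] -/
theorem lerayProjFun_apply (φ : EuclideanSpace ℝ ι → EuclideanSpace ℝ ι) (x : EuclideanSpace ℝ ι) :
    lerayProjFun φ x = realPart (𝓕⁻ (fun ξ => leraySymbolC ξ (fourierVec φ ξ)) x) := rfl

/-- `𝓕⁻[P̂ φ̂]` is continuous (Fourier integral of an `L¹` function). [folklore] -/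
theorem IsSchwartzField.continuous_fourierInv_leraySymbolC
    {φ : EuclideanSpace ℝ ι → EuclideanSpace ℝ ι} (hφ : IsSchwartzField φ) :
    Continuous (𝓕⁻ (fun ξ : EuclideanSpace ℝ ι => leraySymbolC ξ (fourierVec φ ξ))) := by
  rw [Real.fourierInv_eq_fourier_comp_neg]
  exact FunctionSpaces.continuous_fourierIntegral (hφ.integrable_leraySymbolC_fourierVec.comp_neg)

/-- `𝓕⁻[P̂ φ̂] ∈ L²` (Plancherel on `L¹ ∩ L²`, tree `FunctionSpaces.memLp_two_fourierIntegral`;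
Stein–Weiss 1971, Ch. I, Thm. 2.3). [folklore] -/
theorem IsSchwartzField.memLp_two_fourierInv_leraySymbolC
    {φ : EuclideanSpace ℝ ι → EuclideanSpace ℝ ι} (hφ : IsSchwartzField φ) :
    MemLp (𝓕⁻ (fun ξ : EuclideanSpace ℝ ι => leraySymbolC ξ (fourierVec φ ξ))) 2
      (volume : Measure (EuclideanSpace ℝ ι)) := by
  rw [Real.fourierInv_eq_fourier_comp_neg]
  refine FunctionSpaces.memLp_two_fourierIntegral
    (hφ.integrable_leraySymbolC_fourierVec.comp_neg) ?_
  exact hφ.memLp_two_leraySymbolC_fourierVec.comp_measurePreserving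
    (Measure.measurePreserving_neg volume)

/-- `P φ` is continuous for a Schwartz field `φ`. [folklore] -/
theorem IsSchwartzField.continuous_lerayProjFun {φ : EuclideanSpace ℝ ι → EuclideanSpace ℝ ι}
    (hφ : IsSchwartzField φ) :
    Continuous (lerayProjFun φ) :=
  continuous_realPart.comp hφ.continuous_fourierInv_leraySymbolC

/-- **`P φ ∈ L²`** for a Schwartz field `φ` (`ℙ` is bounded on `L²`, here through Plancherel for
the explicit representative `Re 𝓕⁻[P̂ φ̂]`; Lemarié-Rieusset 2002, Ch. 11).
[cite: LemarieRieusset2002, Ch. 11] -/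
theorem IsSchwartzField.memLp_two_lerayProjFun {φ : EuclideanSpace ℝ ι → EuclideanSpace ℝ ι}
    (hφ : IsSchwartzField φ) :
    MemLp (lerayProjFun φ) 2 (volume : Measure (EuclideanSpace ℝ ι)) := by
  have hle : ∀ z : EuclideanSpace ℂ ι, ‖realPart z‖ ≤ ‖z‖ := fun z => by
    have h := lipschitzWith_one_realPart.dist_le_mul z 0
    have h0 : realPart (0 : EuclideanSpace ℂ ι) = 0 := by ext i; simp
    simpa [h0, dist_zero_right] using h
  exact hφ.memLp_two_fourierInv_leraySymbolC.of_le hφ.continuous_lerayProjFun.aestronglyMeasurable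
    (Eventually.of_forall fun _ => hle _)

end SchwartzField


/-! ### Pairings of `P φ` on the Fourier side -/

/-- **The pairing of `P φ` with a compactly supported continuous real field, on the Fourier side**:
`∫ ⟪Pφ, Ψ⟫ = Re ∫ ⟨P̂ φ̂, 𝓕 Ψℂ⟩` (duality `∫⟨𝓕⁻g, Ψ⟩ = ∫⟨g, 𝓕Ψ⟩`; Stein–Weiss 1971, Ch. I,
Thm. 1.15). [folklore] -/
theorem IsSchwartzField.integral_inner_lerayProjFun_eq_re
    {φ : EuclideanSpace ℝ ι → EuclideanSpace ℝ ι} (hφ : IsSchwartzField φ)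
    {Ψr : EuclideanSpace ℝ ι → EuclideanSpace ℝ ι} (hΨc : Continuous Ψr)
    (hΨs : HasCompactSupport Ψr) :
    ∫ x, ⟪lerayProjFun φ x, Ψr x⟫_ℝ =
      (∫ ξ, ⟪leraySymbolC ξ (fourierVec φ ξ), 𝓕 (complexify ∘ Ψr) ξ⟫_ℂ).re := by
  set g : EuclideanSpace ℝ ι → EuclideanSpace ℂ ι := fun ξ => leraySymbolC ξ (fourierVec φ ξ)
    with hg
  set Ψ : EuclideanSpace ℝ ι → EuclideanSpace ℂ ι := complexify ∘ Ψr with hΨ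
  have hgi : Integrable g := hφ.integrable_leraySymbolC_fourierVec
  have hΨcont : Continuous Ψ := continuous_complexify.comp hΨc
  have hΨsupp : HasCompactSupport Ψ := hΨs.comp_left (map_zero _)
  have hΨi : Integrable Ψ := hΨcont.integrable_of_hasCompactSupport hΨsupp
  have hFc : Continuous (𝓕⁻ g) := hφ.continuous_fourierInv_leraySymbolC
  -- pointwise: the real pairing is the real part of the complex pairing
  have h1 : ∀ x, ⟪lerayProjFun φ x, Ψr x⟫_ℝ = (⟪𝓕⁻ g x, Ψ x⟫_ℂ).re := fun x =>
    inner_realPart_left _ _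
  simp_rw [h1]
  -- integrability of the complex pairing (continuous with compact support)
  have hpi : Integrable (fun x => ⟪𝓕⁻ g x, Ψ x⟫_ℂ) := by
    refine (hFc.inner hΨcont).integrable_of_hasCompactSupport ?_
    refine HasCompactSupport.intro hΨsupp fun x hx => ?_
    rw [image_eq_zero_of_notMem_tsupport hx, inner_zero_right]
  have h2 : ∫ x, (⟪𝓕⁻ g x, Ψ x⟫_ℂ).re = (∫ x, ⟪𝓕⁻ g x, Ψ x⟫_ℂ).re := by
    have h := reCLM.integral_comp_comm hpi
    simpa only [reCLM_apply] using h
  rw [h2, integral_inner_fourierInv_left_eq hgi hΨi]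

/-- Coordinates of the gradient on `ℝ^ι`: `(∇θ)ⱼ = ∂ⱼθ`. [folklore] -/
theorem gradient_apply_eq_fderiv [DecidableEq ι] (θ : EuclideanSpace ℝ ι → ℝ)
    (x : EuclideanSpace ℝ ι) (j : ι) :
    gradient θ x j = fderiv ℝ θ x (EuclideanSpace.single j 1) := by
  have h := EuclideanSpace.inner_single_right j (1 : ℝ) (gradient θ x)
  simp only [one_mul, conj_trivial] at h
  rw [← h, gradient, InnerProductSpace.toDual_symm_apply]

/-- **`P φ` is weakly divergence free** (Lemarié-Rieusset 2002, Ch. 11: `ℙ` maps onto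
divergence-free fields; here for the function-level `lerayProjFun` of a test field): for every test
`θ`, `∫ ⟪Pφ, ∇θ⟫ = Re ∫ ⟨P̂φ̂, 2πi ξ θ̂⟩ = 0` because `P̂(ξ)φ̂(ξ) ⊥ ξ`.
[cite: LemarieRieusset2002, Ch. 11] -/
theorem IsSchwartzField.isWeaklyDivFree_lerayProjFun {φ : EuclideanSpace ℝ ι → EuclideanSpace ℝ ι}
    (hφ : IsSchwartzField φ) :
    IsWeaklyDivFree (lerayProjFun φ) := by
  classical
  intro θ hθ
  have hθ1 : ContDiff ℝ 1 θ := hθ.contDiff.of_le (by exact_mod_cast le_top)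
  have hgc : Continuous (gradient θ) :=
    (InnerProductSpace.toDual ℝ (EuclideanSpace ℝ ι)).symm.continuous.comp
      (hθ.contDiff.continuous_fderiv (by simp))
  have hgs : HasCompactSupport (gradient θ) :=
    (hθ.hasCompactSupport.fderiv (𝕜 := ℝ)).comp_left
      (g := (InnerProductSpace.toDual ℝ (EuclideanSpace ℝ ι)).symm) (map_zero _)
  rw [hφ.integral_inner_lerayProjFun_eq_re hgc hgs]
  -- the Fourier-side integrand vanishes identically
  suffices h : ∀ ξ, ⟪leraySymbolC ξ (fourierVec φ ξ), 𝓕 (complexify ∘ gradient θ) ξ⟫_ℂ = 0 by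
    simp [h]
  intro ξ
  have hΘi : Integrable (complexify ∘ gradient θ) :=
    (continuous_complexify.comp hgc).integrable_of_hasCompactSupport (hgs.comp_left (map_zero _))
  -- coordinates of `𝓕 (∇θ)ℂ`: `2πi ξⱼ θ̂(ξ)`
  have hcoordF : ∀ j, 𝓕 (complexify ∘ gradient θ) ξ j =
      (2 * π * I * (ξ j : ℂ)) * 𝓕 (fun x => (θ x : ℂ)) ξ := by
    intro j
    rw [LerayDivFree.fourier_apply_coord hΘi]
    have hgrad : (fun x => (complexify ∘ gradient θ) x j) =
        fun x => ((fderiv ℝ θ x (EuclideanSpace.single j 1) : ℝ) : ℂ) := by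
      funext x
      simp only [Function.comp_apply, complexify_apply, gradient_apply_eq_fderiv]
    rw [hgrad, fourier_fderiv_apply_ofReal hθ1 hθ.hasCompactSupport,
      EuclideanSpace.inner_single_right]
    simp
  -- `⟨g, 𝓕Θ⟩ = 2πi θ̂ · conj (∑ⱼ ξⱼ gⱼ) = 0`
  have hsum : ∑ j, conj (leraySymbolC ξ (fourierVec φ ξ) j) * (ξ j : ℂ) = 0 := by
    have h := congrArg conj (sum_mul_leraySymbolC_apply ξ (fourierVec φ ξ))
    rw [map_sum, map_zero] at h
    rw [← h]
    refine Finset.sum_congr rfl fun j _ => ?_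
    rw [map_mul, Complex.conj_ofReal, mul_comm]
  calc ⟪leraySymbolC ξ (fourierVec φ ξ), 𝓕 (complexify ∘ gradient θ) ξ⟫_ℂ
      = ∑ j, (2 * π * I * (ξ j : ℂ)) * 𝓕 (fun x => (θ x : ℂ)) ξ *
          conj (leraySymbolC ξ (fourierVec φ ξ) j) := by
        rw [PiLp.inner_apply]
        refine Finset.sum_congr rfl fun j _ => ?_
        rw [RCLike.inner_apply, hcoordF]
    _ = (2 * π * I * 𝓕 (fun x => (θ x : ℂ)) ξ) *
          ∑ j, conj (leraySymbolC ξ (fourierVec φ ξ) j) * (ξ j : ℂ) := by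
        rw [Finset.mul_sum]
        exact Finset.sum_congr rfl fun j _ => by ring
    _ = 0 := by rw [hsum, mul_zero]

/-- **`φ − P φ ⊥ 𝒱`** (Lemarié-Rieusset 2002, Ch. 11; Temam 1977, Ch. I, Thm. 1.4: `ℙ` is the
orthogonal projection onto `L²_σ`, `(L²_σ)ᗮ` = gradients): for a divergence-free test field `ψ`,
`∫ ⟪Pφ, ψ⟫ = ∫ ⟪φ, ψ⟫`, since `ψ̂(ξ) ⊥ ξ` makes the symbol invisible, `⟨P̂φ̂, ψ̂⟩ = ⟨φ̂, ψ̂⟩`, and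
`∫ ⟨φ̂, ψ̂⟩ = ∫ ⟨φ, ψ⟩` (duality and Fourier inversion). [cite: LemarieRieusset2002, Ch. 11] -/
theorem IsSchwartzField.integral_inner_lerayProjFun_eq
    {φ ψ : EuclideanSpace ℝ ι → EuclideanSpace ℝ ι} (hφ : IsSchwartzField φ)
    (hψ : IsTestFunctionOn (⊤ : Opens (EuclideanSpace ℝ ι)) ψ) (hdiv : VectorCalculus.IsDivFree ψ) :
    ∫ x, ⟪lerayProjFun φ x, ψ x⟫_ℝ = ∫ x, ⟪φ x, ψ x⟫_ℝ := by
  have hψc : Continuous ψ := hψ.contDiff.continuous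
  rw [hφ.integral_inner_lerayProjFun_eq_re hψc hψ.hasCompactSupport]
  have hΨi : Integrable (complexify ∘ ψ) :=
    (continuous_complexify.comp hψc).integrable_of_hasCompactSupport
      (hψ.hasCompactSupport.comp_left (map_zero _))
  -- `ψ̂(ξ) ⊥ ξ` (`𝓕[div ψ] = 0`, Part 1)
  have hperp : ∀ ξ, ∑ j, (ξ j : ℂ) * 𝓕 (complexify ∘ ψ) ξ j = 0 := fun ξ =>
    LerayDivFree.sum_coord_mul_fourierVec_eq_zero (IsSchwartzField.of_isTestFunctionOn hψ) hdiv ξ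
  have h1 : ∀ ξ, ⟪leraySymbolC ξ (fourierVec φ ξ), 𝓕 (complexify ∘ ψ) ξ⟫_ℂ =
      ⟪fourierVec φ ξ, 𝓕 (complexify ∘ ψ) ξ⟫_ℂ := fun ξ =>
    inner_leraySymbolC_left_of_sum_eq_zero ξ _ _ (hperp ξ)
  simp_rw [h1]
  -- back to physical space: duality and Fourier inversion
  rw [← integral_inner_fourierInv_left_eq (LerayDivFree.integrable_fourierVec hφ) hΨi,
    hφ.fourierInv_fourierVec]
  simp only [Function.comp_apply, inner_complexify]
  rw [integral_complex_ofReal, Complex.ofReal_re]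

/-! ### The discharge -/

/-- **Discharge of `lerayProjFun_ae_eq_lerayProjector`** (Lemarié-Rieusset 2002, Ch. 11: the
Leray projector `ℙ` is the Fourier multiplier `I − ξ ⊗ ξ/|ξ|²`): for `v ∈ L²` with a test-field
representative `φ`, the `L²` Leray projector (orthogonal projection onto `L²_σ`) of `v` is
represented a.e. by `lerayProjFun φ = Re 𝓕⁻[P̂ φ̂]`. Proof: `[Pφ] ∈ L²_σ` (weakly divergence free,
`isWeaklyDivFree_lerayProjFun`, and the tree's `mem_solenoidalL2_iff_holds`), `v − [Pφ] ⊥ 𝒱`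
(`integral_inner_lerayProjFun_eq`) hence `⊥ L²_σ` by continuity, and the orthogonal projection is
characterised by these two properties. [cite: LemarieRieusset2002, Ch. 11] -/
theorem lerayProjFun_ae_eq_lerayProjector_holds : lerayProjFun_ae_eq_lerayProjector (ι := ι) := by
  intro v φ hφ hv
  have hφS : IsSchwartzField φ := IsSchwartzField.of_isTestFunctionOn hφ
  have hP2 : MemLp (lerayProjFun φ) 2 (volume : Measure (EuclideanSpace ℝ ι)) :=
    hφS.memLp_two_lerayProjFun
  set w : Lp (EuclideanSpace ℝ ι) 2 (volume : Measure (EuclideanSpace ℝ ι)) :=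
    hP2.toLp (lerayProjFun φ) with hw_def
  have hw : (w : EuclideanSpace ℝ ι → EuclideanSpace ℝ ι) =ᵐ[volume] lerayProjFun φ :=
    hP2.coeFn_toLp
  -- (1) `w ∈ L²_σ`
  have hwS : w ∈ solenoidalL2 (EuclideanSpace ℝ ι) :=
    (mem_solenoidalL2_iff_holds w).2 (hφS.isWeaklyDivFree_lerayProjFun.congr_ae hw.symm)
  -- (2) `v - w ⊥ L²_σ`
  have hvw : v - w ∈ (solenoidalL2 (EuclideanSpace ℝ ι))ᗮ := by
    rw [Submodule.mem_orthogonal]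
    have hclosed :
        IsClosed {u : Lp (EuclideanSpace ℝ ι) 2 (volume : Measure (EuclideanSpace ℝ ι)) |
          ⟪u, v - w⟫_ℝ = 0} :=
      isClosed_eq (continuous_id.inner continuous_const) continuous_const
    have hφc : Continuous φ := hφ.contDiff.continuous
    have hPc : Continuous (lerayProjFun φ) := hφS.continuous_lerayProjFun
    have hspan : ∀ u ∈ Submodule.span ℝ (smoothSolenoidal (EuclideanSpace ℝ ι)),
        ⟪u, v - w⟫_ℝ = 0 := by
      intro u hu
      induction hu using Submodule.span_induction with
      | mem u hu =>
        obtain ⟨ψ, hψ, hψd, huψ⟩ := hu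
        have hψc : Continuous ψ := hψ.contDiff.continuous
        rw [L2.inner_def]
        have hae : (fun x => ⟪(u : EuclideanSpace ℝ ι → EuclideanSpace ℝ ι) x,
              ((v - w : Lp (EuclideanSpace ℝ ι) 2 (volume : Measure (EuclideanSpace ℝ ι))) :
                EuclideanSpace ℝ ι → EuclideanSpace ℝ ι) x⟫_ℝ) =ᵐ[volume]
            fun x => ⟪φ x, ψ x⟫_ℝ - ⟪lerayProjFun φ x, ψ x⟫_ℝ := by
          filter_upwards [huψ, Lp.coeFn_sub v w, hv, hw] with x h1 h2 h3 h4
          rw [h1, h2, Pi.sub_apply, h3, h4, inner_sub_right, real_inner_comm (φ x),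
            real_inner_comm (lerayProjFun φ x)]
        rw [integral_congr_ae hae,
          integral_sub
            (integrable_inner_of_locallyIntegrable_of_hasCompactSupport
              (hφc.locallyIntegrable (μ := volume)) hψc hψ.hasCompactSupport)
            (integrable_inner_of_locallyIntegrable_of_hasCompactSupport
              (hPc.locallyIntegrable (μ := volume)) hψc hψ.hasCompactSupport),
          hφS.integral_inner_lerayProjFun_eq hψ hψd, sub_self]
      | zero => exact inner_zero_left _
      | add u₁ u₂ _ _ h₁ h₂ => rw [inner_add_left, h₁, h₂, add_zero]
      | smul c u _ h => rw [real_inner_smul_left, h, mul_zero]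
    have hsub :
        ((Submodule.span ℝ (smoothSolenoidal (EuclideanSpace ℝ ι))).topologicalClosure : Set _) ⊆
          {u : Lp (EuclideanSpace ℝ ι) 2 (volume : Measure (EuclideanSpace ℝ ι)) |
            ⟪u, v - w⟫_ℝ = 0} := by
      rw [Submodule.topologicalClosure_coe]
      exact closure_minimal hspan hclosed
    intro u hu
    exact hsub hu
  -- (3) the orthogonal projection is characterised by (1)–(2)
  have hPv : lerayProjector (EuclideanSpace ℝ ι) v = w :=
    Submodule.eq_starProjection_of_mem_orthogonal hwS hvw
  rw [hPv]
  exact hw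

end Literature.Analysis.FluidPDE
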